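import Literature.MathematicalPhysics.QuantumLattice.LiebMattisLadder
import Literature.MathematicalPhysics.QuantumLattice.InfiniteVolumeSpinEntriesProofs
import HarnessLib

/-!
# Matrix elements of the Heisenberg antiferromagnet in the product basis (towards Lieb–Mattis)

Sibling proof file (theorems only, no definitions) of
`Literature/MathematicalPhysics/QuantumLattice/SpinChains.lean`, second of the files discharging
the named fact `marshall_lieb_mattis_spin` (Lieb–Mattis, J. Math. Phys. 3 (1962) 749, Thm 2;
Tasaki (2020) Thm 2.3). In the product basis `|σ⟩`, `σ : Λ → Fin (n+1)` (`σ_x = k ↔ m = n/2 - k`),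
with the weight `W(σ) = Σ_x σ_x`:

* single-site operators act locally (`onSite_mulVec_apply`; two-site entries are
  `onSite_mul_onSite_apply` of `InfiniteVolumeSpinEntriesProofs.lean`); matrices commuting with `Ŝᶻ_tot` are block diagonal in the weight
  (`apply_eq_zero_of_commute_diagonal` and its consequences for `H` and `(𝐒_tot)²`), while `Ŝ^±_tot`
  shift the weight by `∓1`;
* for `x ≠ y`, `𝐒_x · 𝐒_y = Sᶻ_x Sᶻ_y + ½ (S⁺_x S⁻_y + S⁻_x S⁺_y)` (`spinDot_eq_of_ne`); its
  off-diagonal entries are nonnegative reals, nonzero exactly on *hops* (one quantum of `Sᶻ` moved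
  between `x` and `y`), and strictly positive on a hop;
* consequently the Heisenberg Hamiltonian `H = J Σ_{edges} 𝐒_x · 𝐒_y` has real symmetric entries,
  nonnegative off the diagonal for `J ≥ 0`, nonzero on every hop along an edge for `J > 0`, and each
  nonzero off-diagonal entry flips the **Marshall sign** `(-1)^{Σ_{x∈A} σ_x}` when the graph is
  bipartite with parts `A`, `Aᶜ` — so `σ, τ ↦ (-1)^{Σ_A σ} H_{στ} (-1)^{Σ_A τ}` has nonpositive
  off-diagonal entries (Marshall 1955; Lieb–Mattis 1962; Tasaki (2020) §2.4, proof of Thm 2.3).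

## Sources

W. Marshall, Proc. Roy. Soc. A 232 (1955) 48; E. Lieb, D. Mattis, J. Math. Phys. 3 (1962) 749,
proof of Thm 2; H. Tasaki, *Physics and Mathematics of Quantum Many-Body Systems* (2020), §2.4
(eq. (2.4.3) and the proof of Thm 2.3), §2.1 eqs. (2.1.5)–(2.1.7); D. C. Mattis, *The Theory of
Magnetism Made Simple* (2006), §5.10, eq. (5.173). All statements are finite-dimensional matrix
algebra. [folklore]
-/

noncomputable section

open Matrix Complex Finset

namespace Literature.MathematicalPhysics.QuantumLattice

namespace LiebMattis

section General

variable {ι : Type*} [Fintype ι] [DecidableEq ι]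

/-- A matrix commuting with a diagonal matrix has no entries between distinct diagonal values.
[folklore] -/
theorem apply_eq_zero_of_commute_diagonal {d : ι → ℂ} {A : Matrix ι ι ℂ}
    (h : Commute A (diagonal d)) {i j : ι} (hij : d i ≠ d j) : A i j = 0 := by
  have h1 := congrFun (congrFun h.eq i) j
  rw [mul_diagonal, diagonal_mul] at h1
  have h2 : (d j - d i) * A i j = 0 := by linear_combination h1
  rcases mul_eq_zero.1 h2 with h3 | h3
  · exact absurd (sub_eq_zero.1 h3).symm hij
  · exact h3

/-- If `[diag d, A] = A` then `A` only has entries from diagonal value `d j + 1` to `d j`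
(a raising operator for `d`). [folklore] -/
theorem diagonal_eq_add_one_of_apply_ne_zero {d : ι → ℂ} {A : Matrix ι ι ℂ}
    (h : diagonal d * A - A * diagonal d = A) {i j : ι} (hij : A i j ≠ 0) : d i = d j + 1 := by
  have h1 := congrFun (congrFun h i) j
  rw [Matrix.sub_apply, mul_diagonal, diagonal_mul] at h1
  have h2 : (d i - d j - 1) * A i j = 0 := by linear_combination h1
  rcases mul_eq_zero.1 h2 with h3 | h3
  · linear_combination h3
  · exact absurd h3 hij

/-- If `[diag d, A] = -A` then `A` only has entries from diagonal value `d j - 1` to `d j`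
(a lowering operator for `d`). [folklore] -/
theorem diagonal_eq_sub_one_of_apply_ne_zero {d : ι → ℂ} {A : Matrix ι ι ℂ}
    (h : diagonal d * A - A * diagonal d = -A) {i j : ι} (hij : A i j ≠ 0) : d j = d i + 1 := by
  have h1 := congrFun (congrFun h i) j
  rw [Matrix.sub_apply, mul_diagonal, diagonal_mul, Matrix.neg_apply] at h1
  have h2 : (d i - d j + 1) * A i j = 0 := by linear_combination h1
  rcases mul_eq_zero.1 h2 with h3 | h3
  · linear_combination -h3
  · exact absurd h3 hij

omit [DecidableEq ι] in
/-- Support propagation under a matrix: if `A i j ≠ 0` only when `T j → S i`, then `A` maps vectors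
supported in `T` to vectors supported in `S`. [folklore] -/
theorem mulVec_apply_eq_zero_of_support {A : Matrix ι ι ℂ} {ψ : ι → ℂ} {S T : ι → Prop}
    (hA : ∀ i j, A i j ≠ 0 → T j → S i) (hψ : ∀ j, ¬T j → ψ j = 0) (i : ι) (hi : ¬S i) :
    (A *ᵥ ψ) i = 0 := by
  rw [mulVec, dotProduct]
  refine Finset.sum_eq_zero fun j _ => ?_
  by_cases hT : T j
  · by_cases h0 : A i j = 0
    · rw [h0, zero_mul]
    · exact absurd (hA i j h0 hT) hi
  · rw [hψ j hT, mul_zero]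

end General

section QLattice

variable {Λ : Type*} [Fintype Λ] [DecidableEq Λ] {q : ℕ}

/-! ### Local action of single-site and two-site operators -/

/-- **A single-site operator acts on one coordinate**:
`(a_x ψ)(σ) = Σ_l a_{σ_x l} ψ(σ[x ↦ l])`. Tasaki (2020) §2.2, eq. (2.2.5). [folklore] -/
theorem onSite_mulVec_apply (x : Λ) (a : Matrix (Fin q) (Fin q) ℂ) (ψ : TensorIndex Λ q → ℂ)
    (σ : TensorIndex Λ q) :
    ((onSite x a : Op Λ q) *ᵥ ψ) σ = ∑ l : Fin q, a (σ x) l * ψ (Function.update σ x l) := by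
  have hinj : Function.Injective (Function.update σ x : Fin q → TensorIndex Λ q) :=
    Function.update_injective σ x
  have himg : ∀ τ : TensorIndex Λ q, (∀ y, y ≠ x → σ y = τ y) →
      τ = Function.update σ x (τ x) := by
    intro τ h
    funext y
    by_cases hy : y = x
    · subst hy
      simp
    · rw [Function.update_of_ne hy]
      exact (h y hy).symm
  calc ((onSite x a : Op Λ q) *ᵥ ψ) σ
      = ∑ τ ∈ (univ : Finset (Fin q)).image (Function.update σ x), onSite x a σ τ * ψ τ := by
        rw [mulVec, dotProduct]
        symm
        refine Finset.sum_subset (Finset.subset_univ _) fun τ _ hτ => ?_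
        rw [onSite_apply, if_neg, zero_mul]
        intro h
        exact hτ (Finset.mem_image.2 ⟨τ x, mem_univ _, (himg τ h).symm⟩)
    _ = ∑ l : Fin q, onSite x a σ (Function.update σ x l) * ψ (Function.update σ x l) := by
        rw [Finset.sum_image fun l _ l' _ h => hinj h]
    _ = ∑ l : Fin q, a (σ x) l * ψ (Function.update σ x l) := by
        refine Finset.sum_congr rfl fun l _ => ?_
        rw [onSite_apply, if_pos fun y hy => by rw [Function.update_of_ne hy]]
        simp

/-- Entries of a single-site operator are entries of the site matrix or zero; in particular they
are real if the site matrix is real. [folklore] -/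
theorem star_onSite_apply (x : Λ) {a : Matrix (Fin q) (Fin q) ℂ} (ha : ∀ k l, star (a k l) = a k l)
    (σ τ : TensorIndex Λ q) : star ((onSite x a : Op Λ q) σ τ) = onSite x a σ τ := by
  rw [onSite_apply]
  split_ifs
  · exact ha _ _
  · exact star_zero _

variable (n : ℕ)

/-! ### The ladder matrices have nonnegative real entries -/

/-- `⟨k| S⁺ |l⟩` is a nonnegative real number. Tasaki (2020) §2.1, eq. (2.1.6). [folklore] -/
theorem spinRaise_apply_eq_real (k l : Fin (n + 1)) :
    ∃ t : ℝ, 0 ≤ t ∧ spinRaise n k l = t := by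
  rw [spinRaise_apply]
  split_ifs
  · exact ⟨_, Real.sqrt_nonneg _, rfl⟩
  · exact ⟨0, le_rfl, by simp⟩

/-- `⟨k| S⁻ |l⟩` is a nonnegative real number. Tasaki (2020) §2.1, eq. (2.1.6). [folklore] -/
theorem spinLower_apply_eq_real (k l : Fin (n + 1)) :
    ∃ t : ℝ, 0 ≤ t ∧ spinLower n k l = t := by
  rw [spinLower_apply]
  split_ifs
  · exact ⟨_, Real.sqrt_nonneg _, rfl⟩
  · exact ⟨0, le_rfl, by simp⟩

/-- `S⁺` has real entries. [folklore] -/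
theorem star_spinRaise_apply (k l : Fin (n + 1)) : star (spinRaise n k l) = spinRaise n k l := by
  obtain ⟨t, -, ht⟩ := spinRaise_apply_eq_real n k l
  rw [ht, Complex.star_def, Complex.conj_ofReal]

/-- `S⁻` has real entries. [folklore] -/
theorem star_spinLower_apply (k l : Fin (n + 1)) : star (spinLower n k l) = spinLower n k l := by
  obtain ⟨t, -, ht⟩ := spinLower_apply_eq_real n k l
  rw [ht, Complex.star_def, Complex.conj_ofReal]

/-- The hop amplitude `⟨k| S⁺ |k+1⟩ = √((k+1)(n-k))` is strictly positive (`k + 1 ≤ n`).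
Tasaki (2020) §2.1, eq. (2.1.6). [folklore] -/
theorem spinRaise_apply_pos {k l : Fin (n + 1)} (h : l.val = k.val + 1) :
    ∃ t : ℝ, 0 < t ∧ spinRaise n k l = t := by
  refine ⟨_, ?_, by rw [spinRaise_apply, if_pos h]⟩
  have hk : (k.val : ℝ) + 1 ≤ n := by
    have := l.isLt
    exact_mod_cast (by omega : k.val + 1 ≤ n)
  apply Real.sqrt_pos.2
  exact mul_pos (by positivity) (by linarith)

/-- The hop amplitude `⟨l+1| S⁻ |l⟩ = √((l+1)(n-l))` is strictly positive (`l + 1 ≤ n`).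
Tasaki (2020) §2.1, eq. (2.1.6). [folklore] -/
theorem spinLower_apply_pos {k l : Fin (n + 1)} (h : k.val = l.val + 1) :
    ∃ t : ℝ, 0 < t ∧ spinLower n k l = t := by
  refine ⟨_, ?_, by rw [spinLower_apply, if_pos h]⟩
  have hl : (l.val : ℝ) + 1 ≤ n := by
    have := k.isLt
    exact_mod_cast (by omega : l.val + 1 ≤ n)
  apply Real.sqrt_pos.2
  exact mul_pos (by positivity) (by linarith)

/-! ### Weight selection rules -/

/-- **`H` is block diagonal in the weight**: an operator commuting with `Ŝᶻ_tot` has no matrix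
elements between configurations of different weight `Σ_x σ_x`. Tasaki (2020) §2.4, eq. (2.4.5).
[folklore] -/
theorem apply_eq_zero_of_commute_totalSpin_two {A : Op Λ (n + 1)} (h : Commute A (totalSpin n 2))
    {σ τ : TensorIndex Λ (n + 1)} (hw : (∑ x, (σ x : ℕ)) ≠ ∑ x, (τ x : ℕ)) : A σ τ = 0 := by
  rw [totalSpin_two_eq_diagonal] at h
  refine apply_eq_zero_of_commute_diagonal h ?_
  rw [magnetisation_eq_sub_weight, magnetisation_eq_sub_weight]
  intro h'
  apply hw
  have h2 : ((∑ x, (σ x : ℕ) : ℕ) : ℂ) = ((∑ x, (τ x : ℕ) : ℕ) : ℂ) := by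
    have := congrArg (fun z => (((Fintype.card Λ * n : ℕ) : ℂ)) / 2 - z) h'
    simpa using this
  exact_mod_cast h2

/-- **`Ŝ⁺_tot` lowers the weight by one**: `⟨σ| Ŝ⁺_tot |τ⟩ ≠ 0` forces `W(τ) = W(σ) + 1`.
Tasaki (2020) §2.2, App. A.3. [folklore] -/
theorem weight_eq_of_raise_apply_ne_zero {σ τ : TensorIndex Λ (n + 1)}
    (h : (totalSpin n 0 + I • totalSpin n 1 : Op Λ (n + 1)) σ τ ≠ 0) :
    (∑ x, (τ x : ℕ)) = (∑ x, (σ x : ℕ)) + 1 := by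
  have hc := totalSpin_two_commutator_raise (Λ := Λ) n
  rw [totalSpin_two_eq_diagonal] at hc
  have h1 := diagonal_eq_add_one_of_apply_ne_zero hc h
  rw [magnetisation_eq_sub_weight, magnetisation_eq_sub_weight] at h1
  have h2 : ((∑ x, (τ x : ℕ) : ℕ) : ℂ) = ((∑ x, (σ x : ℕ) : ℕ) : ℂ) + 1 := by
    linear_combination h1
  exact_mod_cast h2

/-- **`Ŝ⁻_tot` raises the weight by one**: `⟨σ| Ŝ⁻_tot |τ⟩ ≠ 0` forces `W(σ) = W(τ) + 1`.
Tasaki (2020) §2.2, App. A.3. [folklore] -/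
theorem weight_eq_of_lower_apply_ne_zero {σ τ : TensorIndex Λ (n + 1)}
    (h : (totalSpin n 0 - I • totalSpin n 1 : Op Λ (n + 1)) σ τ ≠ 0) :
    (∑ x, (σ x : ℕ)) = (∑ x, (τ x : ℕ)) + 1 := by
  have hc := totalSpin_two_commutator_lower (Λ := Λ) n
  rw [totalSpin_two_eq_diagonal] at hc
  have h1 := diagonal_eq_sub_one_of_apply_ne_zero hc h
  rw [magnetisation_eq_sub_weight, magnetisation_eq_sub_weight] at h1
  have h2 : ((∑ x, (σ x : ℕ) : ℕ) : ℂ) = ((∑ x, (τ x : ℕ) : ℕ) : ℂ) + 1 := by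
    linear_combination h1
  exact_mod_cast h2

/-- `Ŝ⁺_tot` maps vectors supported in weight `W + 1` to vectors supported in weight `W`.
Tasaki (2020) §2.2, App. A.3. [folklore] -/
theorem raise_mulVec_supported {W : ℕ} {ψ : TensorIndex Λ (n + 1) → ℂ}
    (hψ : ∀ τ, (∑ x, (τ x : ℕ)) ≠ W + 1 → ψ τ = 0) (σ : TensorIndex Λ (n + 1))
    (hσ : (∑ x, (σ x : ℕ)) ≠ W) :
    ((totalSpin n 0 + I • totalSpin n 1 : Op Λ (n + 1)) *ᵥ ψ) σ = 0 :=
  mulVec_apply_eq_zero_of_support (S := fun σ => (∑ x, (σ x : ℕ)) = W)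
    (T := fun τ => (∑ x, (τ x : ℕ)) = W + 1)
    (fun _ _ hA hT => by have := weight_eq_of_raise_apply_ne_zero n hA; omega) hψ σ hσ

/-- `Ŝ⁻_tot` maps vectors supported in weight `W` to vectors supported in weight `W + 1`.
Tasaki (2020) §2.2, App. A.3. [folklore] -/
theorem lower_mulVec_supported {W : ℕ} {ψ : TensorIndex Λ (n + 1) → ℂ}
    (hψ : ∀ τ, (∑ x, (τ x : ℕ)) ≠ W → ψ τ = 0) (σ : TensorIndex Λ (n + 1))
    (hσ : (∑ x, (σ x : ℕ)) ≠ W + 1) :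
    ((totalSpin n 0 - I • totalSpin n 1 : Op Λ (n + 1)) *ᵥ ψ) σ = 0 :=
  mulVec_apply_eq_zero_of_support (S := fun σ => (∑ x, (σ x : ℕ)) = W + 1)
    (T := fun τ => (∑ x, (τ x : ℕ)) = W)
    (fun _ _ hA hT => by have := weight_eq_of_lower_apply_ne_zero n hA; omega) hψ σ hσ

/-- An operator commuting with `Ŝᶻ_tot` preserves every weight sector.
Tasaki (2020) §2.4, eq. (2.4.5). [folklore] -/
theorem mulVec_supported_of_commute_totalSpin_two {A : Op Λ (n + 1)}
    (h : Commute A (totalSpin n 2)) {W : ℕ} {ψ : TensorIndex Λ (n + 1) → ℂ}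
    (hψ : ∀ τ, (∑ x, (τ x : ℕ)) ≠ W → ψ τ = 0) (σ : TensorIndex Λ (n + 1))
    (hσ : (∑ x, (σ x : ℕ)) ≠ W) : (A *ᵥ ψ) σ = 0 :=
  mulVec_apply_eq_zero_of_support (S := fun σ => (∑ x, (σ x : ℕ)) = W)
    (T := fun τ => (∑ x, (τ x : ℕ)) = W)
    (fun i j hA hT => by
      by_contra hS
      exact hA (apply_eq_zero_of_commute_totalSpin_two n h (by rw [hT]; exact hS))) hψ σ hσ

/-! ### The action of `Ŝ⁺_tot` on basis coefficients -/

/-- **`(Ŝ⁺_tot ψ)(σ) = Σ_x Σ_l ⟨σ_x| S⁺ |l⟩ ψ(σ[x ↦ l])`.** Tasaki (2020) §2.2, eq. (2.2.5) with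
(2.1.6). [folklore] -/
theorem raise_mulVec_apply (ψ : TensorIndex Λ (n + 1) → ℂ) (σ : TensorIndex Λ (n + 1)) :
    ((totalSpin n 0 + I • totalSpin n 1 : Op Λ (n + 1)) *ᵥ ψ) σ =
      ∑ x, ∑ l : Fin (n + 1), spinRaise n (σ x) l * ψ (Function.update σ x l) := by
  rw [totalSpin_raise_eq_sum_onSite, Matrix.sum_mulVec, Finset.sum_apply]
  exact Finset.sum_congr rfl fun x _ => onSite_mulVec_apply x _ ψ σ

omit [Fintype Λ] in
/-- The inner sum of `raise_mulVec_apply` has at most one term: `l = σ_x + 1`, with the positive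
amplitude `√((σ_x+1)(n-σ_x))`, present iff `σ_x < n`. Tasaki (2020) §2.1, eq. (2.1.6). [folklore] -/
theorem sum_spinRaise_apply_mul (ψ : TensorIndex Λ (n + 1) → ℂ) (σ : TensorIndex Λ (n + 1)) (x : Λ) :
    (∑ l : Fin (n + 1), spinRaise n (σ x) l * ψ (Function.update σ x l)) =
      if h : (σ x).val + 1 < n + 1 then
        (Real.sqrt (((σ x).val + 1 : ℝ) * (n - (σ x).val : ℝ)) : ℂ) *
          ψ (Function.update σ x ⟨(σ x).val + 1, h⟩)
      else 0 := by
  split_ifs with h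
  · rw [Finset.sum_eq_single ⟨(σ x).val + 1, h⟩]
    · rw [spinRaise_apply, if_pos rfl]
    · intro l _ hl
      rw [spinRaise_apply, if_neg, zero_mul]
      intro hl'
      exact hl (Fin.ext hl')
    · intro h'
      exact absurd (mem_univ _) h'
  · refine Finset.sum_eq_zero fun l _ => ?_
    rw [spinRaise_apply, if_neg, zero_mul]
    intro hl
    have := l.isLt
    omega

/-- Entries of `Ŝ⁺_tot` are nonnegative reals. Tasaki (2020) §2.1–2.2. [folklore] -/
theorem raise_apply_eq_real (σ τ : TensorIndex Λ (n + 1)) :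
    ∃ t : ℝ, 0 ≤ t ∧ (totalSpin n 0 + I • totalSpin n 1 : Op Λ (n + 1)) σ τ = t := by
  rw [totalSpin_raise_eq_sum_onSite, Matrix.sum_apply]
  have hterm : ∀ x : Λ, ∃ t : ℝ, 0 ≤ t ∧ (onSite x (spinRaise n) : Op Λ (n + 1)) σ τ = t := by
    intro x
    rw [onSite_apply]
    split_ifs
    · exact spinRaise_apply_eq_real n _ _
    · exact ⟨0, le_rfl, by simp⟩
  choose t ht0 ht using hterm
  refine ⟨∑ x, t x, Finset.sum_nonneg fun x _ => ht0 x, ?_⟩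
  push_cast
  exact Finset.sum_congr rfl fun x _ => ht x

/-! ### `𝐒_x · 𝐒_y` in terms of ladder operators, and its entries -/

/-- **`𝐒_x · 𝐒_y = Sᶻ_x Sᶻ_y + ½ (S⁺_x S⁻_y + S⁻_x S⁺_y)`** for distinct sites `x ≠ y`.
Tasaki (2020) §2.4, eq. (2.4.3); Mattis (2006) §5.10, eq. (5.173). [folklore] -/
theorem spinDot_eq_of_ne {x y : Λ} (hxy : x ≠ y) :
    spinDot n x y =
      onSite x (SpinOperators.spinZ n) * onSite y (SpinOperators.spinZ n) +
        (1 / 2 : ℂ) • (onSite x (spinRaise n) * onSite y (spinLower n) +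
          onSite x (spinLower n) * onSite y (spinRaise n)) := by
  have hc : ∀ α : Fin 3, (siteSpin n y α * siteSpin n x α : Op Λ (n + 1)) =
      siteSpin n x α * siteSpin n y α := fun α => by
    unfold siteSpin
    exact onSite_mul_onSite_comm (Ne.symm hxy) _ _
  have h1 : spinDot n x y = ∑ α : Fin 3, (siteSpin n x α * siteSpin n y α : Op Λ (n + 1)) := by
    unfold spinDot spinBond
    refine Finset.sum_congr rfl fun α _ => ?_
    rw [hc, ← two_smul ℂ, smul_smul]
    norm_num
  have hP : (onSite x (spinX n) : Op Λ (n + 1)) =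
      (1 / 2 : ℂ) • (onSite x (spinRaise n) + onSite x (spinLower n)) := by
    rw [spinX, onSite_smul', onSite_add']
  have hP' : (onSite y (spinX n) : Op Λ (n + 1)) =
      (1 / 2 : ℂ) • (onSite y (spinRaise n) + onSite y (spinLower n)) := by
    rw [spinX, onSite_smul', onSite_add']
  have hQ : (onSite x (spinY n) : Op Λ (n + 1)) =
      (1 / (2 * I) : ℂ) • (onSite x (spinRaise n) - onSite x (spinLower n)) := by
    rw [spinY, onSite_smul', onSite_sub']
  have hQ' : (onSite y (spinY n) : Op Λ (n + 1)) =
      (1 / (2 * I) : ℂ) • (onSite y (spinRaise n) - onSite y (spinLower n)) := by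
    rw [spinY, onSite_smul', onSite_sub']
  rw [h1, Fin.sum_univ_three]
  simp only [siteSpin, spinVec_zero, spinVec_one, spinVec_two]
  rw [hP, hP', hQ, hQ', smul_mul_smul_comm, smul_mul_smul_comm, one_div_two_mul_I_mul_self]
  simp only [mul_add, add_mul, mul_sub, sub_mul, smul_add, smul_sub, neg_smul]
  module

/-- **Off-diagonal entries of `𝐒_x · 𝐒_y`** (`x ≠ y`, `σ ≠ τ`): only the spin-flip part
contributes, `⟨σ| 𝐒_x · 𝐒_y |τ⟩ = ½ (S⁺_{σ_x τ_x} S⁻_{σ_y τ_y} + S⁻_{σ_x τ_x} S⁺_{σ_y τ_y})` if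
`σ = τ` off `{x, y}`, and `0` otherwise. Tasaki (2020) §2.4, eq. (2.4.3). [folklore] -/
theorem spinDot_apply_of_ne {x y : Λ} (hxy : x ≠ y) {σ τ : TensorIndex Λ (n + 1)} (hστ : σ ≠ τ) :
    spinDot n x y σ τ =
      if (∀ z, z ≠ x → z ≠ y → σ z = τ z) then
        (1 / 2 : ℂ) * (spinRaise n (σ x) (τ x) * spinLower n (σ y) (τ y) +
          spinLower n (σ x) (τ x) * spinRaise n (σ y) (τ y))
      else 0 := by
  have hZ : (onSite x (SpinOperators.spinZ n) * onSite y (SpinOperators.spinZ n) :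
      Op Λ (n + 1)) σ τ = 0 := by
    rw [SpinOperators.spinZ, onSite_diagonal, onSite_diagonal, diagonal_mul_diagonal,
      diagonal_apply_ne _ hστ]
  rw [spinDot_eq_of_ne n hxy, Matrix.add_apply, hZ, zero_add, Matrix.smul_apply, Matrix.add_apply,
    onSite_mul_onSite_apply hxy, onSite_mul_onSite_apply hxy, smul_eq_mul]
  split_ifs <;> simp

/-- **Diagonal entries of `𝐒_x · 𝐒_y`** (`x ≠ y`): `⟨σ| 𝐒_x · 𝐒_y |σ⟩ = (n/2 - σ_x)(n/2 - σ_y)`.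
Tasaki (2020) §2.4, eq. (2.4.3). [folklore] -/
theorem spinDot_apply_self {x y : Λ} (hxy : x ≠ y) (σ : TensorIndex Λ (n + 1)) :
    spinDot n x y σ σ = ((n : ℂ) / 2 - ((σ x : ℕ) : ℂ)) * ((n : ℂ) / 2 - ((σ y : ℕ) : ℂ)) := by
  have hP : spinRaise n (σ x) (σ x) = 0 := by rw [spinRaise_apply, if_neg (by omega)]
  have hP' : spinRaise n (σ y) (σ y) = 0 := by rw [spinRaise_apply, if_neg (by omega)]
  have hc : ∀ z, z ≠ x → z ≠ y → σ z = σ z := fun _ _ _ => rfl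
  rw [spinDot_eq_of_ne n hxy, Matrix.add_apply, Matrix.smul_apply, Matrix.add_apply,
    onSite_mul_onSite_apply hxy, onSite_mul_onSite_apply hxy, onSite_mul_onSite_apply hxy, hP, hP',
    if_pos hc, if_pos hc, if_pos hc, spinZ_apply, spinZ_apply, if_pos rfl, if_pos rfl]
  simp

/-- **The entries of `𝐒_x · 𝐒_y` are real, and nonnegative off the diagonal** (`x ≠ y`).
Marshall (1955); Tasaki (2020) §2.4, proof of Thm 2.3. [folklore] -/
theorem spinDot_apply_eq_real {x y : Λ} (hxy : x ≠ y) (σ τ : TensorIndex Λ (n + 1)) :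
    ∃ t : ℝ, spinDot n x y σ τ = t ∧ (σ ≠ τ → 0 ≤ t) := by
  by_cases hστ : σ = τ
  · subst hστ
    refine ⟨((n : ℝ) / 2 - (σ x : ℕ)) * ((n : ℝ) / 2 - (σ y : ℕ)), ?_, fun h => absurd rfl h⟩
    rw [spinDot_apply_self n hxy]
    push_cast
    ring
  · obtain ⟨a, ha0, ha⟩ := spinRaise_apply_eq_real n (σ x) (τ x)
    obtain ⟨b, hb0, hb⟩ := spinLower_apply_eq_real n (σ y) (τ y)
    obtain ⟨c, hc0, hc⟩ := spinLower_apply_eq_real n (σ x) (τ x)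
    obtain ⟨d, hd0, hd⟩ := spinRaise_apply_eq_real n (σ y) (τ y)
    rw [spinDot_apply_of_ne n hxy hστ, ha, hb, hc, hd]
    split_ifs
    · refine ⟨1 / 2 * (a * b + c * d), by push_cast; ring, fun _ => ?_⟩
      positivity
    · exact ⟨0, by simp, fun _ => le_rfl⟩

/-- **Nonzero off-diagonal entries of `𝐒_x · 𝐒_y` are hops**: if `⟨σ| 𝐒_x · 𝐒_y |τ⟩ ≠ 0` with
`σ ≠ τ`, then `τ` is obtained from `σ` by moving one unit of the label between `x` and `y`
(`τ_x = σ_x + 1`, `σ_y = τ_y + 1`, or the same with `x ↔ y`), all other labels unchanged.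
Tasaki (2020) §2.4, proof of Thm 2.3. [folklore] -/
theorem hop_of_spinDot_apply_ne_zero {x y : Λ} (hxy : x ≠ y) {σ τ : TensorIndex Λ (n + 1)}
    (hστ : σ ≠ τ) (h : spinDot n x y σ τ ≠ 0) :
    ((τ x).val = (σ x).val + 1 ∧ (σ y).val = (τ y).val + 1 ∧ ∀ z, z ≠ x → z ≠ y → σ z = τ z) ∨
      ((τ y).val = (σ y).val + 1 ∧ (σ x).val = (τ x).val + 1 ∧ ∀ z, z ≠ y → z ≠ x → σ z = τ z) := by
  rw [spinDot_apply_of_ne n hxy hστ] at h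
  by_cases hc : ∀ z, z ≠ x → z ≠ y → σ z = τ z
  · rw [if_pos hc] at h
    have h2 : spinRaise n (σ x) (τ x) * spinLower n (σ y) (τ y) ≠ 0 ∨
        spinLower n (σ x) (τ x) * spinRaise n (σ y) (τ y) ≠ 0 := by
      by_contra h3
      push Not at h3
      apply h
      rw [h3.1, h3.2, add_zero, mul_zero]
    rcases h2 with h2 | h2
    · left
      exact ⟨spinRaise_apply_ne_zero n (left_ne_zero_of_mul h2),
        spinLower_apply_ne_zero n (right_ne_zero_of_mul h2), hc⟩
    · right
      exact ⟨spinRaise_apply_ne_zero n (right_ne_zero_of_mul h2),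
        spinLower_apply_ne_zero n (left_ne_zero_of_mul h2), fun z hzy hzx => hc z hzx hzy⟩
  · exact absurd (if_neg hc) h

/-- **A hop has strictly positive amplitude**: if `τ_x = σ_x + 1`, `σ_y = τ_y + 1` and `σ = τ`
elsewhere, then `⟨σ| 𝐒_x · 𝐒_y |τ⟩ = ½ √((σ_x+1)(n-σ_x)) √((τ_y+1)(n-τ_y)) > 0`.
Tasaki (2020) §2.4, proof of Thm 2.3. [folklore] -/
theorem spinDot_apply_pos_of_hop {x y : Λ} (hxy : x ≠ y) {σ τ : TensorIndex Λ (n + 1)}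
    (hx : (τ x).val = (σ x).val + 1) (hy : (σ y).val = (τ y).val + 1)
    (hrest : ∀ z, z ≠ x → z ≠ y → σ z = τ z) :
    ∃ t : ℝ, 0 < t ∧ spinDot n x y σ τ = t := by
  have hστ : σ ≠ τ := fun h => by rw [h] at hx; omega
  obtain ⟨a, ha0, ha⟩ := spinRaise_apply_pos n hx
  obtain ⟨b, hb0, hb⟩ := spinLower_apply_pos n hy
  have hc : spinLower n (σ x) (τ x) = 0 := by rw [spinLower_apply, if_neg (by omega)]
  have hd : spinRaise n (σ y) (τ y) = 0 := by rw [spinRaise_apply, if_neg (by omega)]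
  refine ⟨1 / 2 * (a * b), by positivity, ?_⟩
  rw [spinDot_apply_of_ne n hxy hστ, if_pos hrest, ha, hb, hc, hd]
  push_cast
  ring

/-! ### The Marshall sign -/

omit [Fintype Λ] [DecidableEq Λ] in
/-- The Marshall sign is `±1`: its square is `1`. Marshall (1955). [folklore] -/
theorem marshallSign_mul_self (A : Finset Λ) (σ : TensorIndex Λ q) :
    marshallSign A σ * marshallSign A σ = 1 := by
  rw [marshallSign, ← pow_add, ← two_mul, pow_mul]
  norm_num

omit [Fintype Λ] [DecidableEq Λ] in
/-- The Marshall sign is real. Marshall (1955). [folklore] -/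
theorem star_marshallSign (A : Finset Λ) (σ : TensorIndex Λ q) :
    star (marshallSign A σ) = marshallSign A σ := by
  rw [marshallSign, star_pow, star_neg, star_one]

omit [Fintype Λ] [DecidableEq Λ] in
/-- The Marshall sign is `1` or `-1`. Marshall (1955). [folklore] -/
theorem marshallSign_eq_or (A : Finset Λ) (σ : TensorIndex Λ q) :
    marshallSign A σ = 1 ∨ marshallSign A σ = -1 := by
  rw [marshallSign]
  exact neg_one_pow_eq_or ℂ _

omit [Fintype Λ] in
/-- **A hop across the sublattice boundary flips the Marshall sign**: if `τ` is obtained from `σ`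
by a hop between `x` and `y` with exactly one of `x`, `y` in `A`, then
`(-1)^{Σ_A σ} (-1)^{Σ_A τ} = -1`. Marshall (1955); Lieb–Mattis (1962), proof of Thm 2;
Tasaki (2020) §2.4, proof of Thm 2.3. [folklore] -/
theorem marshallSign_mul_marshallSign_of_hop (A : Finset Λ) {x y : Λ}
    (hA : x ∈ A ↔ y ∉ A) {σ τ : TensorIndex Λ q}
    (hx : (τ x).val = (σ x).val + 1) (hy : (σ y).val = (τ y).val + 1)
    (hrest : ∀ z, z ≠ x → z ≠ y → σ z = τ z) :
    marshallSign A σ * marshallSign A τ = -1 := by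
  have key : (∑ z ∈ A, (τ z : ℕ)) = (∑ z ∈ A, (σ z : ℕ)) + 1 ∨
      (∑ z ∈ A, (σ z : ℕ)) = (∑ z ∈ A, (τ z : ℕ)) + 1 := by
    by_cases hxA : x ∈ A
    · left
      have hyA : y ∉ A := hA.1 hxA
      rw [← Finset.add_sum_erase A _ hxA, ← Finset.add_sum_erase A _ hxA, hx]
      have : ∑ z ∈ A.erase x, (τ z : ℕ) = ∑ z ∈ A.erase x, (σ z : ℕ) :=
        Finset.sum_congr rfl fun z hz => by
          rw [hrest z (Finset.ne_of_mem_erase hz) (fun h => hyA (h ▸ Finset.mem_of_mem_erase hz))]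
      rw [this]
      ring
    · right
      have hyA : y ∈ A := by
        by_contra h
        exact hxA (hA.2 h)
      rw [← Finset.add_sum_erase A _ hyA, ← Finset.add_sum_erase A _ hyA, hy]
      have : ∑ z ∈ A.erase y, (σ z : ℕ) = ∑ z ∈ A.erase y, (τ z : ℕ) :=
        Finset.sum_congr rfl fun z hz => by
          rw [hrest z (fun h => hxA (h ▸ Finset.mem_of_mem_erase hz)) (Finset.ne_of_mem_erase hz)]
      rw [this]
      ring
  rcases key with h | h
  · rw [marshallSign, marshallSign, h, pow_succ, ← mul_assoc, ← pow_add, ← two_mul, pow_mul]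
    norm_num
  · rw [marshallSign, marshallSign, h, pow_succ, mul_assoc, mul_comm (-1 : ℂ), ← mul_assoc,
      ← pow_add, ← two_mul, pow_mul]
    norm_num

/-! ### Entries of the Heisenberg Hamiltonian -/

section Graph

variable (G : SimpleGraph Λ) [DecidableRel G.Adj] (J : ℝ)

/-- Entries of the Heisenberg Hamiltonian: `⟨σ| H |τ⟩ = J Σ_{e ∈ E(G)} ⟨σ| 𝐒_e |τ⟩`.
Tasaki (2020) §2.4, eq. (2.4.1). [folklore] -/
theorem heisenbergHamiltonian_apply (σ τ : TensorIndex Λ (n + 1)) :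
    heisenbergHamiltonian n G J σ τ = (J : ℂ) * ∑ e ∈ G.edgeFinset, spinDotSym n e σ τ := by
  rw [heisenbergHamiltonian, Matrix.smul_apply, Matrix.sum_apply, smul_eq_mul]

/-- Every edge term of `H` has real entries, nonnegative off the diagonal. Marshall (1955);
Tasaki (2020) §2.4, proof of Thm 2.3. [folklore] -/
theorem spinDotSym_apply_eq_real {e : Sym2 Λ} (he : e ∈ G.edgeFinset) (σ τ : TensorIndex Λ (n + 1)) :
    ∃ t : ℝ, spinDotSym n e σ τ = t ∧ (σ ≠ τ → 0 ≤ t) := by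
  revert he
  induction e using Sym2.ind with
  | h x y =>
    intro he
    rw [SimpleGraph.mem_edgeFinset, SimpleGraph.mem_edgeSet] at he
    rw [spinDotSym_mk]
    exact spinDot_apply_eq_real n he.ne σ τ

/-- **`H` has real entries.** Marshall (1955); Tasaki (2020) §2.4, proof of Thm 2.3. [folklore] -/
theorem star_heisenbergHamiltonian_apply (σ τ : TensorIndex Λ (n + 1)) :
    star (heisenbergHamiltonian n G J σ τ) = heisenbergHamiltonian n G J σ τ := by
  rw [heisenbergHamiltonian_apply, star_mul', star_sum, Complex.star_def, Complex.conj_ofReal]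
  congr 1
  refine Finset.sum_congr rfl fun e he => ?_
  obtain ⟨t, ht, -⟩ := spinDotSym_apply_eq_real n G he σ τ
  rw [ht, Complex.conj_ofReal]

/-- **`H` is a real symmetric matrix**: `⟨σ| H |τ⟩ = ⟨τ| H |σ⟩`. Tasaki (2020) §2.4. [folklore] -/
theorem heisenbergHamiltonian_apply_comm (σ τ : TensorIndex Λ (n + 1)) :
    heisenbergHamiltonian n G J σ τ = heisenbergHamiltonian n G J τ σ := by
  rw [← (heisenbergHamiltonian_isHermitian n G J).apply σ τ, star_heisenbergHamiltonian_apply]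

/-- **Off-diagonal entries of `H` are nonnegative reals** for `J ≥ 0`. Marshall (1955);
Tasaki (2020) §2.4, proof of Thm 2.3. [folklore] -/
theorem heisenbergHamiltonian_apply_eq_real (hJ : 0 ≤ J) {σ τ : TensorIndex Λ (n + 1)}
    (hστ : σ ≠ τ) : ∃ t : ℝ, 0 ≤ t ∧ heisenbergHamiltonian n G J σ τ = t := by
  have hterm : ∀ e ∈ G.edgeFinset, ∃ t : ℝ, 0 ≤ t ∧ spinDotSym n e σ τ = t := by
    intro e he
    obtain ⟨t, ht, ht0⟩ := spinDotSym_apply_eq_real n G he σ τ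
    exact ⟨t, ht0 hστ, ht⟩
  choose t ht0 ht using hterm
  refine ⟨J * ∑ e ∈ G.edgeFinset.attach, t e.1 e.2,
    mul_nonneg hJ (Finset.sum_nonneg fun e _ => ht0 e.1 e.2), ?_⟩
  rw [heisenbergHamiltonian_apply, ← Finset.sum_attach]
  push_cast
  congr 1
  exact Finset.sum_congr rfl fun e _ => ht e.1 e.2

/-- **The Marshall-conjugated Hamiltonian has nonpositive off-diagonal entries**: on a bipartite
graph with parts `A`, `Aᶜ` and for `J ≥ 0`, `Re ((-1)^{Σ_A σ} ⟨σ| H |τ⟩ (-1)^{Σ_A τ}) ≤ 0` for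
`σ ≠ τ` (every nonzero off-diagonal entry is a hop along an edge, which crosses between `A` and
`Aᶜ`). Marshall (1955); Lieb–Mattis (1962), proof of Thm 2; Tasaki (2020) §2.4, proof of
Thm 2.3; Mattis (2006) §5.10, eq. (5.173). [folklore] -/
theorem re_marshall_heisenbergHamiltonian_marshall_nonpos (A : Finset Λ)
    (hA : G.IsBipartiteWith (A : Set Λ) (↑A)ᶜ) (hJ : 0 ≤ J) {σ τ : TensorIndex Λ (n + 1)}
    (hστ : σ ≠ τ) :
    (marshallSign A σ * heisenbergHamiltonian n G J σ τ * marshallSign A τ).re ≤ 0 := by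
  have hterm : ∀ e ∈ G.edgeFinset,
      (marshallSign A σ * marshallSign A τ * spinDotSym n e σ τ).re ≤ 0 := by
    intro e he
    revert he
    induction e using Sym2.ind with
    | h x y =>
      intro he
      rw [SimpleGraph.mem_edgeFinset, SimpleGraph.mem_edgeSet] at he
      rw [spinDotSym_mk]
      by_cases h0 : spinDot n x y σ τ = 0
      · rw [h0, mul_zero, Complex.zero_re]
      obtain ⟨t, ht, ht0⟩ := spinDot_apply_eq_real n he.ne σ τ
      have hbip : ∀ {u v : Λ}, G.Adj u v → (u ∈ A ↔ v ∉ A) := by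
        intro u v huv
        rcases hA.mem_of_adj huv with ⟨hu, hv⟩ | ⟨hu, hv⟩
        · exact ⟨fun _ => hv, fun _ => hu⟩
        · exact ⟨fun h => absurd h hu, fun h => absurd hv h⟩
      have hsign : marshallSign A σ * marshallSign A τ = -1 := by
        rcases hop_of_spinDot_apply_ne_zero n he.ne hστ h0 with ⟨hx, hy, hrest⟩ | ⟨hy, hx, hrest⟩
        · exact marshallSign_mul_marshallSign_of_hop A (hbip he) hx hy hrest
        · exact marshallSign_mul_marshallSign_of_hop A (hbip he.symm) hy hx hrest
      rw [hsign, ht, neg_one_mul, Complex.neg_re, Complex.ofReal_re, neg_nonpos]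
      exact ht0 hστ
  have hre : marshallSign A σ * heisenbergHamiltonian n G J σ τ * marshallSign A τ =
      (J : ℂ) * ∑ e ∈ G.edgeFinset, marshallSign A σ * marshallSign A τ * spinDotSym n e σ τ := by
    simp only [heisenbergHamiltonian_apply, Finset.mul_sum, Finset.sum_mul]
    refine Finset.sum_congr rfl fun e _ => ?_
    ring
  rw [hre, Complex.re_ofReal_mul, Complex.re_sum]
  exact mul_nonpos_iff.2 (Or.inl ⟨hJ, Finset.sum_nonpos hterm⟩)

/-- **A hop along an edge is a nonzero matrix element of `H`** (`J > 0`): if `x ∼ y` in `G` and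
`τ` is obtained from `σ` by `τ_x = σ_x + 1`, `σ_y = τ_y + 1`, then `Re ⟨σ| H |τ⟩ > 0`.
Lieb–Mattis (1962), proof of Thm 2 (connectivity of the configuration graph);
Tasaki (2020) §2.4, proof of Thm 2.3. [folklore] -/
theorem re_heisenbergHamiltonian_apply_pos_of_hop (hJ : 0 < J) {x y : Λ} (hadj : G.Adj x y)
    {σ τ : TensorIndex Λ (n + 1)} (hx : (τ x).val = (σ x).val + 1)
    (hy : (σ y).val = (τ y).val + 1) (hrest : ∀ z, z ≠ x → z ≠ y → σ z = τ z) :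
    0 < (heisenbergHamiltonian n G J σ τ).re := by
  have hστ : σ ≠ τ := fun h => by rw [h] at hx; omega
  have he : s(x, y) ∈ G.edgeFinset := by
    rw [SimpleGraph.mem_edgeFinset, SimpleGraph.mem_edgeSet]
    exact hadj
  have hterm : ∀ e ∈ G.edgeFinset, 0 ≤ (spinDotSym n e σ τ).re := by
    intro e he'
    obtain ⟨t, ht, ht0⟩ := spinDotSym_apply_eq_real n G he' σ τ
    rw [ht, Complex.ofReal_re]
    exact ht0 hστ
  obtain ⟨t, ht0, ht⟩ := spinDot_apply_pos_of_hop n hadj.ne hx hy hrest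
  rw [heisenbergHamiltonian_apply, Complex.re_ofReal_mul, Complex.re_sum]
  refine mul_pos hJ (lt_of_lt_of_le ?_ (Finset.single_le_sum hterm he))
  rw [spinDotSym_mk, ht, Complex.ofReal_re]
  exact ht0

/-- `H` preserves the weight: `⟨σ| H |τ⟩ = 0` unless `W(σ) = W(τ)`. Tasaki (2020) §2.4,
eq. (2.4.5). [folklore] -/
theorem heisenbergHamiltonian_apply_eq_zero_of_weight_ne {σ τ : TensorIndex Λ (n + 1)}
    (hw : (∑ x, (σ x : ℕ)) ≠ ∑ x, (τ x : ℕ)) : heisenbergHamiltonian n G J σ τ = 0 :=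
  apply_eq_zero_of_commute_totalSpin_two n (commute_heisenbergHamiltonian_totalSpin n G J 2) hw

end Graph

end QLattice

end LiebMattis

end Literature.MathematicalPhysics.QuantumLattice
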